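import Summits.QuantumFields.YangMills.Theorems.BalabanUVNodesN20KeyedRelWeightCanonical

/-!
# BalabanUVNodes ∕ N20 (NE7b) — THE PERSISTENT-ACTIVITY FRACTION OF RECORD IS THE WORST-SOURCE RELATIVE MASS OF THE PERSISTENCE CLASS IN THE TWO DRESSED PARTITION FUNCTIONS.
# On the live-selector line (E1 ∕ E2 + positivity of the dressed partition functions of record) the canonical weight of the spine reading of record at step `K` is
# `W K = sup_{|t| ≤ 1} max ( Σ_{bad} weightA₁₃ K t ∕ Z_{K₀+K}(t) , Σ_{bad} weightB₁₃ K t ∕ Z_{K₀+K+1}(t) )`, so the N20 face of K3⁷ v3 stub 2 at the pinned reading reads, with NO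
# residual letter: «the worst-source fractions of the tuple's own dressed partition functions carried by the histories with a large-field region at a level `≤ jc(K)` are `< 1` at
# every step and summable over the steps»

Cell `pub-ymgap` (HUMAN RULING D-0062 Track A; work-bound push D-0149, director-ym №197), width seat `pub-ymgap-dag-n20-w2` (gen 2) on node N20 = NE7b; CLAIM-3 of the re-seat,
continuation of CLAIM-1 `…N20KeyedRelWeightOverCut` (p597397) and CLAIM-2 `…N20KeyedRelWeightCanonical`.  Filed `--kind proof --supports stmt-QuantumFields-20544 --as helper` (K3⁷
`SpineGivenEndpointR13SepCoPH`); COUNT-NEUTRAL; LOCATED.  [III] = [Balaban1988Convergent], [LF-II] = [Balaban1989LargeFieldII], [UV3] = [Balaban1985UV3].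

WHY.  CLAIM-2 reduced the N20 face at the reading of record to two numeric conditions on ONE definite sequence `W = wInf …` ∈ [0, 1] (the least admissible relative weight of the
persistence class), hypothesis-free.  `W` is still an infimum over an abstract admissible set.  On the LIVE-SELECTOR line the two runs' keyed totals ARE the dressed partition
functions `Z_{K₀+K}(t)`, `Z_{K₀+K+1}(t)` of the tuple's own datum (dag-n20-d's E1 ∕ E2), which are POSITIVE (`schemeZ_pos_datumOfRecord₁₃CoPH`) — so the admissible set is a closed
half-line and its infimum is an explicit SUPREMUM OF FRACTIONS:
* §1 (generic `ι`, folklore; non-negative terms, `Bad ⊆ T`, POSITIVE totals on `|t| ≤ l₀`, `0 ≤ l₀`) `frac_left_le_of_mem_admW` ∕ `frac_right_le_of_mem_admW` · `frac_left_le_wInf` ∕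
  `frac_right_le_wInf` · `bddAbove_fracSet` · `fracSet_nonempty` · `sSup_fracSet_mem_admW` · ★ `wInf_eq_sSup_frac` (`wInf … K = sSup {max (badA t ∕ totA t) (badB t ∕ totB t) | |t| ≤ l₀}`);
* §2 (the reading of record ON THE LIVE LINE: pin `hsel`, (H-U) `LocalBgMeasurable`, (H-ζ) `ZetaMeasurable`, `0 ≤ ζ` read off `hP`) `sum_classSet₁₃_weightA_pos_of_sel` ∕ `…weightB_pos` (the
  keyed totals are positive: E1∕E2 + `schemeZ_pos`) · `badMass_le_W_mul_schemeZ_left ∕ _right` (`Σ_{bad} weightA₁₃ K t ≤ W K · Z_{K₀+K}(t)`, `… weightB₁₃ … ≤ W K · Z_{K₀+K+1}(t)`) ·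
  `badFrac_le_W_left ∕ _right` · ★★ `W_crOfRecord₁₃VAt_eq_sSup_badFrac` (the formula above at `crOfRecord₁₃VAt K₀ jcut sh …`) · `W_crOfRecord₁₃At_eq_sSup_badFrac` (v1.0 twin);
* §3 ★★ `relWeightBound_crOfRecord₁₃VAt_iff_badFrac` — on a live tuple the N20 face at the reading ⟺ `(∀ K, sSup badFrac K < 1) ∧ Summable (K ↦ sSup badFrac K)`: NE7b AT THE RECORD
  under the policy `jcut`, written on Bałaban's own dressed partition functions of the tuple and NOTHING ELSE.
Cited BY NAME, not re-typed: dag-n20-d `…SpineCanonicalWeights` (`admW`, `wInf`, `wInf_le_of_mem`), `…SpineReadingOfRecord13CoPH(V)` (`schemeZ_eq_sum_classSet_weightA`,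
`schemeZ_succ_eq_sum_classSet_weightB`, the reading's dictionary), CLAIM-2 `…N20KeyedRelWeightCanonical` (`wInf_mem`, `bad_left_wInf`, `relWeightBound_crOfRecord₁₃VAt_iff`), gen 0
`…N21KeyedShellWeightShellZero` (`weightA₁₃_nonneg`, `weightB₁₃_nonneg`, `zeta_nonneg_of_provisos₁₃CoPH`), `…N20AtRecord13CoPH.schemeZ_pos_datumOfRecord₁₃CoPH`, `T4WeightBudget.RelWeightBound` :117.

HONEST FRAMING.  Real-analysis ∕ finite-sum bookkeeping; NO fraction bounded, NO estimate proved; a located reading of the registered stub text, count-neutral.  Nothing of Bałaban's is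
asserted; NE7 ∕ NE7b ∕ NE7c NOT PRINTED for `d = 4`, NOT proved; (α)-instance 0∕1; no `Provisos₁₃CoPH` inhabitant claimed (K0⁷ OPEN); N19 ∕ N20 ∕ N21 ∕ N27 NOT discharged; K3⁷ NOT
closed; counts unmoved (typed 28∕28 · discharged 5∕27); no count claim (the chair's single count line is the only count).  One finite `𝕋⁴_{L^K}` programme at fixed `ε = L^{−K}`,
Bałaban AS PRINTED; the YM mass gap (Clay) is NOT proved by any of this — R4 closes the conditional finite-𝕋⁴ rung `BalabanLadder.UV` only; NOT ℝ⁴, NOT infinite volume, NOT OS.  No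
`def`, no `instance`, no `notation`, no `sorry`.  Sources (locators, bookkeeping only): [III] (2.18) p.257; [LF-II] Thm 1 + (0.1) pp.355–356, (1.80) p.384; [UV3] (6) p.257; [King1986]
(3.10)–(3.11) p.656.
-/

noncomputable section

open scoped BigOperators

namespace Summit.QuantumFields.YangMills.BalabanUVNodes.N20KeyedRelWeightFraction

open Literature.MathematicalPhysics.QuantumFieldTheory.Balaban1983to89 Literature.MathematicalPhysics.QuantumFieldTheory.Balaban1983to89.Node00
open T4Continuum
open T4WeightBudget (RelWeightBound)
open YMDAG.UVSplit hiding SU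
open Summit.QuantumFields.YangMills.BalabanUVNodes.SpineCanonicalWeights
open Summit.QuantumFields.YangMills.Theorems.N20AtRecord13 (schemeZ_pos_datumOfRecord₁₃CoPH)
open Summit.QuantumFields.YangMills.BalabanUVNodes.N21KeyedShellWeightShellZero (zeta_nonneg_of_provisos₁₃CoPH weightA₁₃_nonneg weightB₁₃_nonneg)
open Summit.QuantumFields.YangMills.BalabanUVNodes.N20KeyedRelWeightCanonical

/-! ## §1  Folklore: with positive totals the admissible weights are a closed half-line and the canonical weight is a supremum of fractions -/

section Generic

variable {ι : Type*} {l₀ : ℝ} {T : ℕ → Finset ι} {A B : ℕ → ℝ → ι → ℝ} {Bad : ℕ → ℝ → Finset ι}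

/-- An admissible weight dominates run A's bad FRACTION at every admissible source with positive total. [cite: King1986, (3.10)–(3.11) p.656 (bookkeeping)] -/
theorem frac_left_le_of_mem_admW {K : ℕ} {w : ℝ} (hw : w ∈ admW l₀ T A B Bad K) {t : ℝ} (ht : |t| ≤ l₀) (hpos : 0 < ∑ τ ∈ T K, A K t τ) :
    (∑ τ ∈ Bad K t, A K t τ) / ∑ τ ∈ T K, A K t τ ≤ w :=
  (div_le_iff₀ hpos).2 (hw.2 t ht).1

/-- … and run B's. [cite: King1986, (3.10)–(3.11) p.656 (bookkeeping)] -/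
theorem frac_right_le_of_mem_admW {K : ℕ} {w : ℝ} (hw : w ∈ admW l₀ T A B Bad K) {t : ℝ} (ht : |t| ≤ l₀) (hpos : 0 < ∑ τ ∈ T K, B K t τ) :
    (∑ τ ∈ Bad K t, B K t τ) / ∑ τ ∈ T K, B K t τ ≤ w :=
  (div_le_iff₀ hpos).2 (hw.2 t ht).2

variable (hA : ∀ (K : ℕ) (t : ℝ), |t| ≤ l₀ → ∀ τ ∈ T K, 0 ≤ A K t τ) (hB : ∀ (K : ℕ) (t : ℝ), |t| ≤ l₀ → ∀ τ ∈ T K, 0 ≤ B K t τ)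
  (hsub : ∀ (K : ℕ) (t : ℝ), |t| ≤ l₀ → Bad K t ⊆ T K)
include hA hB hsub

/-- **THE CANONICAL WEIGHT DOMINATES run A's BAD FRACTION** at every admissible source with positive total (non-negative terms, `Bad ⊆ T`: the canonical weight is admissible, CLAIM-2's
`wInf_mem`). [cite: King1986, (3.10)–(3.11) p.656 (bookkeeping)] -/
theorem frac_left_le_wInf (K : ℕ) {t : ℝ} (ht : |t| ≤ l₀) (hpos : 0 < ∑ τ ∈ T K, A K t τ) :
    (∑ τ ∈ Bad K t, A K t τ) / ∑ τ ∈ T K, A K t τ ≤ wInf l₀ T A B Bad K :=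
  frac_left_le_of_mem_admW (wInf_mem hA hB hsub K) ht hpos

/-- **… AND run B's.** [cite: King1986, (3.10)–(3.11) p.656 (bookkeeping)] -/
theorem frac_right_le_wInf (K : ℕ) {t : ℝ} (ht : |t| ≤ l₀) (hpos : 0 < ∑ τ ∈ T K, B K t τ) :
    (∑ τ ∈ Bad K t, B K t τ) / ∑ τ ∈ T K, B K t τ ≤ wInf l₀ T A B Bad K :=
  frac_right_le_of_mem_admW (wInf_mem hA hB hsub K) ht hpos

variable (htotA : ∀ (K : ℕ) (t : ℝ), |t| ≤ l₀ → 0 < ∑ τ ∈ T K, A K t τ) (htotB : ∀ (K : ℕ) (t : ℝ), |t| ≤ l₀ → 0 < ∑ τ ∈ T K, B K t τ)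
include htotA htotB

/-- The set of worst-of-two bad fractions over the source window is bounded above (by the canonical weight). [cite: King1986, (3.10)–(3.11) p.656 (bookkeeping)] -/
theorem bddAbove_fracSet (K : ℕ) :
    BddAbove ((fun t : ℝ => max ((∑ τ ∈ Bad K t, A K t τ) / ∑ τ ∈ T K, A K t τ) ((∑ τ ∈ Bad K t, B K t τ) / ∑ τ ∈ T K, B K t τ)) '' {t : ℝ | |t| ≤ l₀}) :=
  ⟨wInf l₀ T A B Bad K, by
    rintro _ ⟨t, ht, rfl⟩
    exact max_le (frac_left_le_wInf hA hB hsub K ht (htotA K t ht)) (frac_right_le_wInf hA hB hsub K ht (htotB K t ht))⟩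

omit hA hB hsub htotA htotB in
/-- The source window is non-empty (`t = 0`) when `0 ≤ l₀`, so the fraction set is non-empty. [cite: Balaban1985UV3, (6) p.257 (bookkeeping)] -/
theorem fracSet_nonempty (hl₀ : 0 ≤ l₀) (K : ℕ) :
    ((fun t : ℝ => max ((∑ τ ∈ Bad K t, A K t τ) / ∑ τ ∈ T K, A K t τ) ((∑ τ ∈ Bad K t, B K t τ) / ∑ τ ∈ T K, B K t τ)) '' {t : ℝ | |t| ≤ l₀}).Nonempty :=
  ⟨_, 0, by simpa [abs_zero] using hl₀, rfl⟩

/-- **THE SUPREMUM OF THE BAD FRACTIONS IS ADMISSIBLE** (positive totals, `0 ≤ l₀`). [cite: King1986, (3.10)–(3.11) p.656 (bookkeeping)] -/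
theorem sSup_fracSet_mem_admW (hl₀ : 0 ≤ l₀) (K : ℕ) :
    sSup ((fun t : ℝ => max ((∑ τ ∈ Bad K t, A K t τ) / ∑ τ ∈ T K, A K t τ) ((∑ τ ∈ Bad K t, B K t τ) / ∑ τ ∈ T K, B K t τ)) '' {t : ℝ | |t| ≤ l₀}) ∈
      admW l₀ T A B Bad K := by
  have hbdd := bddAbove_fracSet hA hB hsub htotA htotB K
  have h0 : |(0 : ℝ)| ≤ l₀ := by simpa [abs_zero] using hl₀
  have hle : ∀ t : ℝ, |t| ≤ l₀ →
      max ((∑ τ ∈ Bad K t, A K t τ) / ∑ τ ∈ T K, A K t τ) ((∑ τ ∈ Bad K t, B K t τ) / ∑ τ ∈ T K, B K t τ) ≤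
        sSup ((fun t : ℝ => max ((∑ τ ∈ Bad K t, A K t τ) / ∑ τ ∈ T K, A K t τ) ((∑ τ ∈ Bad K t, B K t τ) / ∑ τ ∈ T K, B K t τ)) '' {t : ℝ | |t| ≤ l₀}) :=
    fun t ht => le_csSup hbdd ⟨t, ht, rfl⟩
  refine ⟨?_, fun t ht => ⟨?_, ?_⟩⟩
  · refine le_trans ?_ (hle 0 h0)
    exact le_max_of_le_left (div_nonneg (Finset.sum_nonneg fun τ hτ => hA K 0 h0 τ (hsub K 0 h0 hτ)) (htotA K 0 h0).le)
  · exact (div_le_iff₀ (htotA K t ht)).1 ((le_max_left _ _).trans (hle t ht))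
  · exact (div_le_iff₀ (htotB K t ht)).1 ((le_max_right _ _).trans (hle t ht))

/-- **★ WITH POSITIVE TOTALS THE CANONICAL WEIGHT IS THE WORST-SOURCE BAD FRACTION**: `wInf … K = sup_{|t| ≤ l₀} max (badA t ∕ totA t) (badB t ∕ totB t)` (non-negative terms, `Bad ⊆ T`,
`0 ≤ l₀`). [cite: King1986, (3.10)–(3.11) p.656; Balaban1989LargeFieldII, (1.80) p.384 (bookkeeping)] -/
theorem wInf_eq_sSup_frac (hl₀ : 0 ≤ l₀) (K : ℕ) :
    wInf l₀ T A B Bad K =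
      sSup ((fun t : ℝ => max ((∑ τ ∈ Bad K t, A K t τ) / ∑ τ ∈ T K, A K t τ) ((∑ τ ∈ Bad K t, B K t τ) / ∑ τ ∈ T K, B K t τ)) '' {t : ℝ | |t| ≤ l₀}) := by
  refine le_antisymm (wInf_le_of_mem (sSup_fracSet_mem_admW hA hB hsub htotA htotB hl₀ K)) (csSup_le (fracSet_nonempty hl₀ K) ?_)
  rintro _ ⟨t, ht, rfl⟩
  exact max_le (frac_left_le_wInf hA hB hsub K ht (htotA K t ht)) (frac_right_le_wInf hA hB hsub K ht (htotB K t ht))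

end Generic

/-! ## §2  At the spine reading of record on the live line: the keyed totals are the dressed partition functions, which are positive -/

section Reading

variable {F : T4Family} {N : ℕ} [NeZero N] (θ : Stage13HParams F N) (hP : θ.Provisos₁₃CoPH F N) (K₀ : ℕ) (g₀ : ℕ → ℝ) (os : List (ULoop F)) (E : B12.RunParams → ℝ)
  (hsel : θ.ppSel = ppSelLiveOfRecord F N θ.ν θ.τ9 E (wOfRecord₉ F N θ.toStage9Params)) (hU : LocalBgMeasurable F N θ.ν) (hζm : ZetaMeasurable F N θ.ζ)
include hsel hU hζm

/-- **run A's KEYED TOTAL OF RECORD IS POSITIVE ON THE LIVE LINE** (E1: it IS `Z_{K₀+K}(t)`; `schemeZ_pos_datumOfRecord₁₃CoPH`), every step and EVERY source, any selector letter `E` in the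
pin; the `LiveSel` instance (`E := EOfRecord₁₃ …`) is dag-n20-w1's `…PolicyWall.sum_classSet₁₃_weightA₁₃_pos_of_liveSel` (p597932). [cite: Balaban1985UV3, (6) p.257; Balaban1988Convergent, (2.18) p.257 (bookkeeping)] -/
theorem sum_classSet₁₃_weightA_pos_of_sel (K : ℕ) (t : ℝ) : 0 < ∑ x ∈ classSet₁₃ θ K₀ g₀ K, weightA₁₃ θ hP K₀ g₀ os K t x := by
  rw [← schemeZ_eq_sum_classSet_weightA K₀ θ hP E hsel hU hζm (zeta_nonneg_of_provisos₁₃CoPH F θ hP) g₀ os K t]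
  exact schemeZ_pos_datumOfRecord₁₃CoPH θ hP g₀ os (K₀ + K) t

/-- **run B's KEYED TOTAL OF RECORD IS POSITIVE ON THE LIVE LINE** (E2: it IS `Z_{K₀+K+1}(t)`). [cite: Balaban1985UV3, (6) p.257; Balaban1988Convergent, (2.18) p.257 (bookkeeping)] -/
theorem sum_classSet₁₃_weightB_pos_of_sel (K : ℕ) (t : ℝ) : 0 < ∑ x ∈ classSet₁₃ θ K₀ g₀ K, weightB₁₃ θ hP K₀ g₀ os K t x := by
  rw [← schemeZ_succ_eq_sum_classSet_weightB K₀ θ hP E hsel hU hζm (zeta_nonneg_of_provisos₁₃CoPH F θ hP) g₀ os K t]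
  exact schemeZ_pos_datumOfRecord₁₃CoPH θ hP g₀ os (K₀ + K + 1) t

variable (jcut : ℕ → ℕ) (sh : ShellSplit₁₃CoPH N K₀)

/-- **THE PERSISTENCE CLASS CARRIES AT MOST THE FRACTION `W K` OF run A's DRESSED PARTITION FUNCTION OF RECORD**: `Σ_{bad} weightA₁₃ K t ≤ W K · Z_{K₀+K}(t)` on `|t| ≤ 1` at the reading's OWN
canonical `W` (CLAIM-2's `badMass_le_W_crOfRecord₁₃VAt_left` through E1). [cite: Balaban1989LargeFieldII, Thm 1 + (0.1) pp.355–356, (1.80) p.384; King1986, (3.10)–(3.11) p.656 (bookkeeping)] -/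
theorem badMass_le_W_mul_schemeZ_left (K : ℕ) {t : ℝ} (ht : |t| ≤ 1) :
    ∑ x ∈ badClass₁₃ θ K₀ g₀ jcut K t, weightA₁₃ θ hP K₀ g₀ os K t x ≤
      (crOfRecord₁₃VAt K₀ jcut sh F θ hP g₀ os).W K * T4GenFunBounds.schemeZ ((datumOfRecord₁₃CoPH F N θ hP).scheme g₀) os (K₀ + K) t := by
  rw [schemeZ_eq_sum_classSet_weightA K₀ θ hP E hsel hU hζm (zeta_nonneg_of_provisos₁₃CoPH F θ hP) g₀ os K t]
  exact badMass_le_W_crOfRecord₁₃VAt_left θ hP K₀ g₀ os jcut sh K ht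

/-- **… AND OF run B's**: `Σ_{bad} weightB₁₃ K t ≤ W K · Z_{K₀+K+1}(t)`. [cite: Balaban1989LargeFieldII, Thm 1 + (0.1) pp.355–356, (1.80) p.384; King1986, (3.10)–(3.11) p.656 (bookkeeping)] -/
theorem badMass_le_W_mul_schemeZ_right (K : ℕ) {t : ℝ} (ht : |t| ≤ 1) :
    ∑ x ∈ badClass₁₃ θ K₀ g₀ jcut K t, weightB₁₃ θ hP K₀ g₀ os K t x ≤
      (crOfRecord₁₃VAt K₀ jcut sh F θ hP g₀ os).W K * T4GenFunBounds.schemeZ ((datumOfRecord₁₃CoPH F N θ hP).scheme g₀) os (K₀ + K + 1) t := by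
  rw [schemeZ_succ_eq_sum_classSet_weightB K₀ θ hP E hsel hU hζm (zeta_nonneg_of_provisos₁₃CoPH F θ hP) g₀ os K t]
  exact badMass_le_W_crOfRecord₁₃VAt_right θ hP K₀ g₀ os jcut sh K ht

/-- **THE BAD FRACTION OF run A's DRESSED PARTITION FUNCTION IS `≤ W K`** on `|t| ≤ 1`. [cite: Balaban1989LargeFieldII, (1.80) p.384; King1986, (3.10)–(3.11) p.656 (bookkeeping)] -/
theorem badFrac_le_W_left (K : ℕ) {t : ℝ} (ht : |t| ≤ 1) :
    (∑ x ∈ badClass₁₃ θ K₀ g₀ jcut K t, weightA₁₃ θ hP K₀ g₀ os K t x) / T4GenFunBounds.schemeZ ((datumOfRecord₁₃CoPH F N θ hP).scheme g₀) os (K₀ + K) t ≤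
      (crOfRecord₁₃VAt K₀ jcut sh F θ hP g₀ os).W K :=
  (div_le_iff₀ (schemeZ_pos_datumOfRecord₁₃CoPH θ hP g₀ os (K₀ + K) t)).2 (badMass_le_W_mul_schemeZ_left θ hP K₀ g₀ os E hsel hU hζm jcut sh K ht)

/-- **… AND OF run B's.** [cite: Balaban1989LargeFieldII, (1.80) p.384; King1986, (3.10)–(3.11) p.656 (bookkeeping)] -/
theorem badFrac_le_W_right (K : ℕ) {t : ℝ} (ht : |t| ≤ 1) :
    (∑ x ∈ badClass₁₃ θ K₀ g₀ jcut K t, weightB₁₃ θ hP K₀ g₀ os K t x) / T4GenFunBounds.schemeZ ((datumOfRecord₁₃CoPH F N θ hP).scheme g₀) os (K₀ + K + 1) t ≤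
      (crOfRecord₁₃VAt K₀ jcut sh F θ hP g₀ os).W K :=
  (div_le_iff₀ (schemeZ_pos_datumOfRecord₁₃CoPH θ hP g₀ os (K₀ + K + 1) t)).2 (badMass_le_W_mul_schemeZ_right θ hP K₀ g₀ os E hsel hU hζm jcut sh K ht)

/-- **★★ THE PERSISTENT-ACTIVITY FRACTION OF RECORD IS THE WORST-SOURCE BAD FRACTION OF THE TWO DRESSED PARTITION FUNCTIONS** (live line; physical-volume edition):
`(crOfRecord₁₃VAt K₀ jcut sh …).W K = sup_{|t| ≤ 1} max ( Σ_{bad} weightA₁₃ K t ∕ Z_{K₀+K}(t) , Σ_{bad} weightB₁₃ K t ∕ Z_{K₀+K+1}(t) )`.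
[cite: Balaban1985UV3, (6) p.257; Balaban1989LargeFieldII, Thm 1 + (0.1) pp.355–356, (1.80) p.384; King1986, (3.10)–(3.11) p.656 (bookkeeping)] -/
theorem W_crOfRecord₁₃VAt_eq_sSup_badFrac (K : ℕ) :
    (crOfRecord₁₃VAt K₀ jcut sh F θ hP g₀ os).W K =
      sSup ((fun t : ℝ => max
          ((∑ x ∈ badClass₁₃ θ K₀ g₀ jcut K t, weightA₁₃ θ hP K₀ g₀ os K t x) / T4GenFunBounds.schemeZ ((datumOfRecord₁₃CoPH F N θ hP).scheme g₀) os (K₀ + K) t)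
          ((∑ x ∈ badClass₁₃ θ K₀ g₀ jcut K t, weightB₁₃ θ hP K₀ g₀ os K t x) / T4GenFunBounds.schemeZ ((datumOfRecord₁₃CoPH F N θ hP).scheme g₀) os (K₀ + K + 1) t)) ''
        {t : ℝ | |t| ≤ 1}) := by
  have h := wInf_eq_sSup_frac (l₀ := 1) (T := classSet₁₃ θ K₀ g₀) (A := weightA₁₃ θ hP K₀ g₀ os) (B := weightB₁₃ θ hP K₀ g₀ os) (Bad := badClass₁₃ θ K₀ g₀ jcut)
    (fun K t _ x _ => weightA₁₃_nonneg F θ hP K₀ g₀ os K t x) (fun K t _ x _ => weightB₁₃_nonneg F θ hP K₀ g₀ os K t x) (fun K t _ => badClass₁₃_subset θ K₀ g₀ jcut K t)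
    (fun K t _ => sum_classSet₁₃_weightA_pos_of_sel θ hP K₀ g₀ os E hsel hU hζm K t) (fun K t _ => sum_classSet₁₃_weightB_pos_of_sel θ hP K₀ g₀ os E hsel hU hζm K t) zero_le_one K
  refine h.trans ?_
  congr 1
  refine Set.image_congr fun t _ => ?_
  rw [schemeZ_eq_sum_classSet_weightA K₀ θ hP E hsel hU hζm (zeta_nonneg_of_provisos₁₃CoPH F θ hP) g₀ os K t,
    schemeZ_succ_eq_sum_classSet_weightB K₀ θ hP E hsel hU hζm (zeta_nonneg_of_provisos₁₃CoPH F θ hP) g₀ os K t]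

/-- **THE v1.0 TWIN** (`crOfRecord₁₃At`; the weight does not read `vol`). [cite: Balaban1989LargeFieldII, (1.80) p.384; King1986, (3.10)–(3.11) p.656 (bookkeeping)] -/
theorem W_crOfRecord₁₃At_eq_sSup_badFrac (K : ℕ) :
    (crOfRecord₁₃At K₀ jcut sh F θ hP g₀ os).W K =
      sSup ((fun t : ℝ => max
          ((∑ x ∈ badClass₁₃ θ K₀ g₀ jcut K t, weightA₁₃ θ hP K₀ g₀ os K t x) / T4GenFunBounds.schemeZ ((datumOfRecord₁₃CoPH F N θ hP).scheme g₀) os (K₀ + K) t)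
          ((∑ x ∈ badClass₁₃ θ K₀ g₀ jcut K t, weightB₁₃ θ hP K₀ g₀ os K t x) / T4GenFunBounds.schemeZ ((datumOfRecord₁₃CoPH F N θ hP).scheme g₀) os (K₀ + K + 1) t)) ''
        {t : ℝ | |t| ≤ 1}) :=
  W_crOfRecord₁₃VAt_eq_sSup_badFrac θ hP K₀ g₀ os E hsel hU hζm jcut sh K

/-! ## §3  NE7b AT THE RECORD, written on the dressed partition functions and nothing else -/

/-- **★★ ON A LIVE TUPLE THE N20 FACE OF K3⁷ v3 STUB 2 AT THE PINNED READING ⟺ THE WORST-SOURCE BAD FRACTIONS OF THE TUPLE's OWN DRESSED PARTITION FUNCTIONS ARE `< 1` AT EVERY STEP AND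
SUMMABLE** (CLAIM-2's `relWeightBound_crOfRecord₁₃VAt_iff` with `W` replaced by §2's formula): under the policy `jcut`, for every `K`,
`sup_{|t| ≤ 1} max ( Σ_{x ∈ badClass₁₃ … jcut K t} weightA₁₃ K t x ∕ Z_{K₀+K}(t) , Σ_{…} weightB₁₃ K t x ∕ Z_{K₀+K+1}(t) ) < 1`, and these suprema are summable over `K` — the located NE7b content
of record (NOT PRINTED for d = 4, NOT proved), with no residual letter. [cite: Balaban1985UV3, (6) p.257; Balaban1989LargeFieldII, Thm 1 + (0.1) pp.355–356, (1.80) p.384; King1986, (3.10)–(3.11) p.656 (bookkeeping)] -/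
theorem relWeightBound_crOfRecord₁₃VAt_iff_badFrac :
    RelWeightBound (crOfRecord₁₃VAt K₀ jcut sh F θ hP g₀ os).l₀ (crOfRecord₁₃VAt K₀ jcut sh F θ hP g₀ os).T (crOfRecord₁₃VAt K₀ jcut sh F θ hP g₀ os).A
        (crOfRecord₁₃VAt K₀ jcut sh F θ hP g₀ os).B (crOfRecord₁₃VAt K₀ jcut sh F θ hP g₀ os).Bad (crOfRecord₁₃VAt K₀ jcut sh F θ hP g₀ os).W ↔
      (∀ K, sSup ((fun t : ℝ => max
          ((∑ x ∈ badClass₁₃ θ K₀ g₀ jcut K t, weightA₁₃ θ hP K₀ g₀ os K t x) / T4GenFunBounds.schemeZ ((datumOfRecord₁₃CoPH F N θ hP).scheme g₀) os (K₀ + K) t)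
          ((∑ x ∈ badClass₁₃ θ K₀ g₀ jcut K t, weightB₁₃ θ hP K₀ g₀ os K t x) / T4GenFunBounds.schemeZ ((datumOfRecord₁₃CoPH F N θ hP).scheme g₀) os (K₀ + K + 1) t)) ''
        {t : ℝ | |t| ≤ 1}) < 1) ∧
      Summable fun K => sSup ((fun t : ℝ => max
          ((∑ x ∈ badClass₁₃ θ K₀ g₀ jcut K t, weightA₁₃ θ hP K₀ g₀ os K t x) / T4GenFunBounds.schemeZ ((datumOfRecord₁₃CoPH F N θ hP).scheme g₀) os (K₀ + K) t)
          ((∑ x ∈ badClass₁₃ θ K₀ g₀ jcut K t, weightB₁₃ θ hP K₀ g₀ os K t x) / T4GenFunBounds.schemeZ ((datumOfRecord₁₃CoPH F N θ hP).scheme g₀) os (K₀ + K + 1) t)) ''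
        {t : ℝ | |t| ≤ 1}) := by
  have hW : (crOfRecord₁₃VAt K₀ jcut sh F θ hP g₀ os).W = fun K => sSup ((fun t : ℝ => max
          ((∑ x ∈ badClass₁₃ θ K₀ g₀ jcut K t, weightA₁₃ θ hP K₀ g₀ os K t x) / T4GenFunBounds.schemeZ ((datumOfRecord₁₃CoPH F N θ hP).scheme g₀) os (K₀ + K) t)
          ((∑ x ∈ badClass₁₃ θ K₀ g₀ jcut K t, weightB₁₃ θ hP K₀ g₀ os K t x) / T4GenFunBounds.schemeZ ((datumOfRecord₁₃CoPH F N θ hP).scheme g₀) os (K₀ + K + 1) t)) ''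
        {t : ℝ | |t| ≤ 1}) :=
    funext fun K => W_crOfRecord₁₃VAt_eq_sSup_badFrac θ hP K₀ g₀ os E hsel hU hζm jcut sh K
  rw [relWeightBound_crOfRecord₁₃VAt_iff, hW]

end Reading

end Summit.QuantumFields.YangMills.BalabanUVNodes.N20KeyedRelWeightFraction

end
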